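import Summits.SmoothPoincare4.SmoothPoincare4.Theorems.DottedCircleRasmussenDcrGapHelperFriendsCarrierVkAdaptedFieldNeat
import Summits.SmoothPoincare4.SmoothPoincare4.Theorems.DottedCircleRasmussenDcrGapHelperFriendsCarrierVkClockFlow
import Summits.SmoothPoincare4.SmoothPoincare4.Theorems.DottedCircleRasmussenDcrGapHelperFriendsCarrierVkPartBDisc
import Summits.SmoothPoincare4.SmoothPoincare4.Theorems.DottedCircleRasmussenDcrGapHelperFriendsCarrierVkPartBTubeBlend

/-!
# Stub `helper_friendsCarrier_Vk_partB` (Part B of the split of the registered helper `helper_friendsCarrier_Vk`,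
line `mk_friends`, skeleton v8) for crux `DcrGap`
(item stmt-SmoothPoincare4-16128, route route-SmoothPoincare4-DottedCircleRasmussen)

**The flow-conical normal form of the V_k split, with its framed tube.**  For a neat model slice disc
`f₁` of the model knot `K₁ ⊂ M_k`, a tube `νK : 𝕊¹ × ℝ² → M_k` of `K₁` and a transversal framing
`(n₀, n₁)` of `f₁` over the closed disc equal along the circle to the fibre derivatives of `νK`, this file
assembles the datum `(Φ, ε, s₁, s₀, c, g, G)` of the stub from the landed pieces:

* `Φ`: the global flow of the neat-adapted unit-clock field (`…VkAdaptedFieldNeat`), clocked along `M_k`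
  with the band clause (`…VkClockFlow`, `ε = 1/200`);
* `g`: the flow-line reparametrisation of `f₁` (`…VkPartBDisc`: same image, `g(t u) = Φ(1 - t, K₁ u)` on
  the band, `g = f₁ ∘ R` for the logarithmically blended ray reparametrisation `R` of
  `…VkPartBRayRadius` / `…VkPartBRayMono` / `…VkPartBRayReparam`);
* `G(x, w) = G₀(x, c • w)`: the trivialised tube (`FriendsCarrierVk.exists_flowTubeG` below), extracted from
  the blended tube `G₀` of `…VkPartBTubeBlend` (`C^∞` on `B(0, 1 + τ₁) × ℝ²`, `G₀(x, 0) = g x`, equal to the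
  flow-out `C(x, w) = Φ(1 - ‖x‖, νK(x/‖x‖, w))` over `‖x‖ ≥ 1 - s₁`, invertible differential along the zero
  section): over the deep disc `‖x‖ ≤ 1 - s₀` a thin tube is injective, immersive and off `D_k`
  (`…VkPartBTubeLemmas`) and the compact deep tube keeps a level gap `G_k > 1 + s₀` off the poles, i.e.
  misses the collar shell `Φ((0, s₀) × M_k)`; over the band the tube is the flow-out, injective and
  immersive at level `2 - ‖x‖ ∈ (1, 1 + s₁)` (`…VkPartBFlowOut`), hence off `D_k` and disjoint from the deep
  tube — `exists_conicalTube` of the tree's `SliceDiscConicalTube.lean` with norms replaced by levels.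

No definitions, no named facts, no `sorry`.
-/

-- the prescribed namespace `Summit.<P>.<Sub>.…` duplicates `SmoothPoincare4` (P = Sub)
set_option linter.dupNamespace false
set_option linter.style.longLine false

noncomputable section

open scoped Manifold ContDiff Topology
open Function Set Metric TopologicalSpace Literature.Topology.FourManifolds Literature.Topology.FourManifolds.MMSW Literature.AlgebraicTopology.Homotopy.HopfFibration

namespace Summit.SmoothPoincare4.SmoothPoincare4.Theorems.DcrGap.MkFriends

namespace FriendsCarrierVk

open Filter

set_option maxHeartbeats 1600000 in
/-- **The trivialised tube of the reparametrised slice disc.** [cite: Kosinski1993, Ch. III Thm (4.2)] -/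
theorem exists_flowTubeG {k : ℕ} {K₁ : (Metric.sphere (0 : EuclideanSpace ℝ (Fin 2)) 1) → (EuclideanSpace ℝ (Fin 4))}
    {f₁ g : (EuclideanSpace ℝ (Fin 2)) → (EuclideanSpace ℝ (Fin 4))} {Rm : (EuclideanSpace ℝ (Fin 2)) → (EuclideanSpace ℝ (Fin 2))}
    {νK : (Metric.sphere (0 : EuclideanSpace ℝ (Fin 2)) 1) × (EuclideanSpace ℝ (Fin 2)) → (EuclideanSpace ℝ (Fin 4))}
    {Φ : ℝ × (EuclideanSpace ℝ (Fin 4)) → (EuclideanSpace ℝ (Fin 4))} {ε τ₁ : ℝ} {n₀ n₁ : (EuclideanSpace ℝ (Fin 2)) → (EuclideanSpace ℝ (Fin 4))}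
    (hf : IsModelSliceDisc k K₁ f₁)
    (hν : ContMDiff ((𝓡 1).prod 𝓘(ℝ, EuclideanSpace ℝ (Fin 2))) 𝓘(ℝ, EuclideanSpace ℝ (Fin 4)) ∞ νK)
    (hνi : Injective νK)
    (hνd : ∀ p, Injective (mfderiv ((𝓡 1).prod 𝓘(ℝ, EuclideanSpace ℝ (Fin 2))) 𝓘(ℝ, EuclideanSpace ℝ (Fin 4)) νK p))
    (hνM : ∀ p, νK p ∈ modelBoundary k)
    (hν0 : ∀ u : (Metric.sphere (0 : EuclideanSpace ℝ (Fin 2)) 1), νK (u, 0) = K₁ u)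
    (hΦs : ContDiff ℝ ∞ Φ) (h0 : ∀ x, Φ (0, x) = x) (hadd : ∀ s t x, Φ (s, Φ (t, x)) = Φ (s + t, x))
    (hclock : ∀ x ∈ modelBoundary k, ∀ s : ℝ, |s| ≤ 2 * ε →
      (∀ j, (1 : ℝ) / 2 < holeTerm k j (Φ (s, x))) ∧ levelFun k (Φ (s, x)) = 1 + s)
    (hε : 0 < ε)
    (hg : IsModelSliceDisc k K₁ g) (hτ₁ : 0 < τ₁) (hτ₁1 : τ₁ ≤ 1 / 4)
    (hgR : ∀ x : EuclideanSpace ℝ (Fin 2), ‖x‖ < 1 + τ₁ → g x = f₁ (Rm x))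
    (hRs : ∀ x : EuclideanSpace ℝ (Fin 2), ‖x‖ < 1 + τ₁ → ContDiffAt ℝ ∞ Rm x)
    (hRimm : ∀ x : EuclideanSpace ℝ (Fin 2), ‖x‖ < 1 + τ₁ → Injective (fderiv ℝ Rm x))
    (hRle : ∀ x : EuclideanSpace ℝ (Fin 2), ‖x‖ ≤ 1 → ‖Rm x‖ ≤ 1) (hRcirc : ∀ x : EuclideanSpace ℝ (Fin 2), ‖x‖ = 1 → Rm x = x)
    (hgout : ∀ x : EuclideanSpace ℝ (Fin 2), 1 - τ₁ ≤ ‖x‖ → g x = Φ (1 - ‖x‖, f₁ (unitVec x)))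
    (hn₀ : ContDiff ℝ ∞ n₀) (hn₁ : ContDiff ℝ ∞ n₁)
    (htrans : ∀ x ∈ closedBall (0 : EuclideanSpace ℝ (Fin 2)) 1, ∀ (v : EuclideanSpace ℝ (Fin 2)) (a b : ℝ),
      fderiv ℝ f₁ x v + a • n₀ x + b • n₁ x = 0 → v = 0 ∧ a = 0 ∧ b = 0)
    (hbdry : ∀ u : (Metric.sphere (0 : EuclideanSpace ℝ (Fin 2)) 1),
      n₀ u = fderiv ℝ (fun w : EuclideanSpace ℝ (Fin 2) => νK (u, w)) 0 (EuclideanSpace.single 0 1) ∧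
      n₁ u = fderiv ℝ (fun w : EuclideanSpace ℝ (Fin 2) => νK (u, w)) 0 (EuclideanSpace.single 1 1)) :
    ∃ (s₁ s₀ c : ℝ) (G : (EuclideanSpace ℝ (Fin 2)) × (EuclideanSpace ℝ (Fin 2)) → EuclideanSpace ℝ (Fin 4)),
      0 < s₀ ∧ s₀ < s₁ ∧ s₁ < τ₁ ∧ s₁ < 2 * ε ∧ 0 < c ∧ c ≤ 1 ∧
      ContDiffOn ℝ ∞ G (ball 0 1 ×ˢ ball 0 2) ∧ InjOn G (ball 0 1 ×ˢ ball 0 2) ∧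
      (∀ q ∈ ball 0 1 ×ˢ ball 0 2, Injective (fderiv ℝ G q)) ∧
      (∀ q ∈ ball 0 1 ×ˢ ball 0 2, G q ∉ modelHandlebody k) ∧
      (∀ x ∈ ball 0 1, G (x, 0) = g x) ∧
      (∀ (u : (Metric.sphere (0 : EuclideanSpace ℝ (Fin 2)) 1)) (t : ℝ) (w : EuclideanSpace ℝ (Fin 2)), 1 - s₁ < t → t < 1 → ‖w‖ < 2 →
        G (t • (u : EuclideanSpace ℝ (Fin 2)), w) = Φ (1 - t, νK (u, c • w))) ∧
      (∀ (x w : EuclideanSpace ℝ (Fin 2)), ‖x‖ ≤ 1 - s₀ → ‖w‖ < 2 → ∀ a ∈ modelBoundary k, ∀ s : ℝ, 0 < s → s < s₀ →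
        G (x, w) ≠ Φ (s, a)) := by
  obtain ⟨s₁, G₀, hs₁, hs₁τ, hs₁ε, hG₀s, hG₀zero, hG₀band, hG₀der⟩ :=
    exists_blendTube hf hν hν0 hΦs h0 hε hg hτ₁ hτ₁1 hgR hRs hRimm hRle hRcirc hgout hn₀ hn₁ htrans hbdry
  -- the open domain of smoothness
  set Ω : Set ((EuclideanSpace ℝ (Fin 2)) × (EuclideanSpace ℝ (Fin 2))) :=
    ball (0 : EuclideanSpace ℝ (Fin 2)) (1 + τ₁) ×ˢ (univ : Set (EuclideanSpace ℝ (Fin 2))) with hΩ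
  have hΩo : IsOpen Ω := isOpen_ball.prod isOpen_univ
  have hsubΩ : ∀ {R' : ℝ}, R' ≤ 1 → closedBall (0 : EuclideanSpace ℝ (Fin 2)) R' ×ˢ (univ : Set (EuclideanSpace ℝ (Fin 2))) ⊆ Ω :=
    fun hR' => prod_mono (closedBall_subset_ball (by linarith)) le_rfl
  have hG₀c : ContinuousOn G₀ Ω := hG₀s.continuousOn
  have hG₀at : ∀ q : (EuclideanSpace ℝ (Fin 2)) × (EuclideanSpace ℝ (Fin 2)), ‖q.1‖ < 1 + τ₁ → ContDiffAt ℝ ∞ G₀ q :=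
    fun q hq => hG₀s.contDiffAt (hΩo.mem_nhds ⟨mem_ball_zero_iff.2 hq, mem_univ _⟩)
  -- the band: the flow-out, in the clock zone
  have hband_abs : ∀ {x : EuclideanSpace ℝ (Fin 2)}, 1 - s₁ < ‖x‖ → ‖x‖ ≤ 1 → |1 - ‖x‖| ≤ 2 * ε := by
    intro x h1 h2; rw [abs_le]; constructor <;> linarith
  have hband_abs' : ∀ {x : EuclideanSpace ℝ (Fin 2)}, 1 - s₁ < ‖x‖ → ‖x‖ ≤ 1 → |1 - ‖x‖| < 2 * ε := by
    intro x h1 h2; rw [abs_lt]; constructor <;> linarith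
  have hband_ne : ∀ {x : EuclideanSpace ℝ (Fin 2)}, 1 - s₁ < ‖x‖ → x ≠ 0 := by
    intro x h1 h; rw [h, norm_zero] at h1; linarith
  -- A. the deep tube off `D_k`, and its level gap
  have hzero_notMem : ∀ x ∈ closedBall (0 : EuclideanSpace ℝ (Fin 2)) (1 - s₁), G₀ (x, 0) ∉ modelHandlebody k := by
    intro x hx
    rw [hG₀zero]
    exact hg.apply_notMem (by linarith [mem_closedBall_zero_iff.1 hx])
  obtain ⟨η₃, hη₃, hnotMem⟩ := exists_notMem_tube hΩo hG₀c (hsubΩ (by linarith)) hzero_notMem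
  set K : Set (EuclideanSpace ℝ (Fin 4)) :=
    G₀ '' (closedBall (0 : EuclideanSpace ℝ (Fin 2)) (1 - s₁) ×ˢ closedBall (0 : EuclideanSpace ℝ (Fin 2)) (η₃ / 2)) with hK
  have hKc : IsCompact K := ((isCompact_closedBall _ _).prod (isCompact_closedBall _ _)).image_of_continuousOn
    (hG₀c.mono (prod_mono (closedBall_subset_ball (by linarith)) (subset_univ _)))
  have hKD : ∀ y ∈ K, y ∉ modelHandlebody k := by
    rintro _ ⟨⟨x, w⟩, ⟨hx, hw⟩, rfl⟩
    exact hnotMem x hx w (by linarith [mem_closedBall_zero_iff.1 hw])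
  obtain ⟨sg, hsg, hgap⟩ := exists_level_gap hKc hKD
  set s₀ : ℝ := min sg (s₁ / 2) with hs₀
  have hs₀pos : 0 < s₀ := lt_min hsg (by linarith)
  have hs₀s₁ : s₀ < s₁ := (min_le_right _ _).trans_lt (by linarith)
  have hs₀sg : s₀ ≤ sg := min_le_left _ _
  -- B. injectivity and invertibility on the deep tube `‖x‖ ≤ 1 - s₀`
  have hinj0 : InjOn (fun x => G₀ (x, 0)) (closedBall (0 : EuclideanSpace ℝ (Fin 2)) (1 - s₀)) := by
    intro x hx y hy hxy
    simp only [hG₀zero] at hxy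
    exact hg.2.1 (closedBall_subset_closedBall (by linarith) hx) (closedBall_subset_closedBall (by linarith) hy) hxy
  have hder0 : ∀ x ∈ closedBall (0 : EuclideanSpace ℝ (Fin 2)) (1 - s₀),
      ∃ e : ((EuclideanSpace ℝ (Fin 2)) × (EuclideanSpace ℝ (Fin 2))) ≃L[ℝ] EuclideanSpace ℝ (Fin 4), HasFDerivAt G₀ (e : _ →L[ℝ] _) (x, 0) :=
    fun x hx => hG₀der x (closedBall_subset_closedBall (by linarith) hx)
  obtain ⟨η₁, hη₁, hinjOn⟩ := exists_injOn_tube hΩo hG₀s (hsubΩ (by linarith)) hinj0 hder0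
  have hder0' : ∀ x ∈ closedBall (0 : EuclideanSpace ℝ (Fin 2)) (1 - s₀), fderiv ℝ G₀ (x, 0) ∈
      range ((↑) : (((EuclideanSpace ℝ (Fin 2)) × (EuclideanSpace ℝ (Fin 2))) ≃L[ℝ] EuclideanSpace ℝ (Fin 4)) →
        ((EuclideanSpace ℝ (Fin 2)) × (EuclideanSpace ℝ (Fin 2))) →L[ℝ] EuclideanSpace ℝ (Fin 4)) := by
    intro x hx
    obtain ⟨e, he⟩ := hder0 x hx
    exact ⟨e, he.fderiv.symm⟩
  obtain ⟨η₂, hη₂, hequiv⟩ := exists_fderiv_equiv_tube hΩo hG₀s (hsubΩ (by linarith)) hder0'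
  -- C. the fibre scale and the tube
  set c : ℝ := min 1 (min η₁ (min η₂ η₃)) / 4 with hc
  have hmin : 0 < min 1 (min η₁ (min η₂ η₃)) := lt_min one_pos (lt_min hη₁ (lt_min hη₂ hη₃))
  have hcpos : 0 < c := by rw [hc]; linarith
  have hc1 : c ≤ 1 := by rw [hc]; linarith [min_le_left 1 (min η₁ (min η₂ η₃))]
  have hcη₁ : 2 * c < η₁ := by
    rw [hc]; linarith [(min_le_right 1 _).trans (min_le_left η₁ (min η₂ η₃))]
  have hcη₂ : 2 * c < η₂ := by
    rw [hc]; linarith [((min_le_right 1 _).trans (min_le_right η₁ _)).trans (min_le_left η₂ η₃)]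
  have hcη₃ : 2 * c ≤ η₃ / 2 := by
    rw [hc]; linarith [((min_le_right 1 _).trans (min_le_right η₁ _)).trans (min_le_right η₂ η₃)]
  have hcw : ∀ {w : EuclideanSpace ℝ (Fin 2)}, ‖w‖ < 2 → ‖c • w‖ < η₁ ∧ ‖c • w‖ < η₂ ∧ ‖c • w‖ ≤ η₃ / 2 := by
    intro w hw
    have hn : ‖c • w‖ = c * ‖w‖ := by rw [norm_smul, Real.norm_of_nonneg hcpos.le]
    have h2 : c * ‖w‖ ≤ 2 * c := by nlinarith [norm_nonneg w]
    rw [hn]; exact ⟨by linarith, by linarith, by linarith⟩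
  set Sc : (EuclideanSpace ℝ (Fin 2)) × (EuclideanSpace ℝ (Fin 2)) →L[ℝ] (EuclideanSpace ℝ (Fin 2)) × (EuclideanSpace ℝ (Fin 2)) :=
    (ContinuousLinearMap.fst ℝ (EuclideanSpace ℝ (Fin 2)) (EuclideanSpace ℝ (Fin 2))).prod
      (c • ContinuousLinearMap.snd ℝ (EuclideanSpace ℝ (Fin 2)) (EuclideanSpace ℝ (Fin 2))) with hSc
  have hSc_apply : ∀ q : (EuclideanSpace ℝ (Fin 2)) × (EuclideanSpace ℝ (Fin 2)), Sc q = (q.1, c • q.2) := fun q => rfl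
  have hSc_inj : Injective Sc := by
    intro a b h
    rw [hSc_apply, hSc_apply, Prod.mk.injEq] at h
    exact Prod.ext h.1 (smul_right_injective _ hcpos.ne' h.2)
  set G : (EuclideanSpace ℝ (Fin 2)) × (EuclideanSpace ℝ (Fin 2)) → EuclideanSpace ℝ (Fin 4) := fun q => G₀ (q.1, c • q.2) with hG
  have hGS : G = G₀ ∘ Sc := funext fun q => rfl
  -- the flow-out form of `G` over the band
  set C : (EuclideanSpace ℝ (Fin 2)) × (EuclideanSpace ℝ (Fin 2)) → EuclideanSpace ℝ (Fin 4) :=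
    fun q => Φ (1 - ‖q.1‖, νK (radialProjection (spherePt 1) q.1, q.2)) with hCdef
  have hGband : ∀ x w : EuclideanSpace ℝ (Fin 2), 1 - s₁ ≤ ‖x‖ → G (x, w) = C (x, c • w) := fun x w hx => hG₀band x (c • w) hx
  -- the deep tube lies in `K`
  have hGK : ∀ x w : EuclideanSpace ℝ (Fin 2), ‖x‖ ≤ 1 - s₁ → ‖w‖ < 2 → G (x, w) ∈ K := fun x w hx hw =>
    ⟨(x, c • w), ⟨mem_closedBall_zero_iff.2 hx, mem_closedBall_zero_iff.2 (hcw hw).2.2⟩, rfl⟩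
  -- a point of `K` is never a collar point `Φ(s, a)` with `0 < s < s₀`
  have hKshell : ∀ y ∈ K, ∀ a ∈ modelBoundary k, ∀ s : ℝ, 0 < s → s < s₀ → y ≠ Φ (s, a) := by
    intro y hy a ha s hs0 hs hya
    have hsε : |s| ≤ 2 * ε := by rw [abs_of_pos hs0]; linarith
    obtain ⟨hhole, hlev⟩ := hclock a ha s hsε
    rw [← hya] at hhole hlev
    have := hgap y hy fun j => (hhole j).le
    linarith
  refine ⟨s₁, s₀, c, G, hs₀pos, hs₀s₁, hs₁τ, hs₁ε, hcpos, hc1, ?_, ?_, ?_, ?_, ?_, ?_, ?_⟩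
  · -- smooth
    rintro ⟨x, w⟩ ⟨hx, -⟩
    rw [mem_ball_zero_iff] at hx
    have h1 : ContDiffAt ℝ ∞ G₀ (Sc (x, w)) := hG₀at _ (by rw [hSc_apply]; simp only; linarith)
    rw [hGS]
    exact (h1.comp (x, w) Sc.contDiff.contDiffAt).contDiffWithinAt
  · -- injective
    rintro ⟨x, w⟩ ⟨hx, hw⟩ ⟨x', w'⟩ ⟨hx', hw'⟩ h
    rw [mem_ball_zero_iff] at hx hw hx' hw'
    change G (x, w) = G (x', w') at h
    -- both on the band: the flow-out is injective
    have hbb : 1 - s₁ < ‖x‖ → 1 - s₁ < ‖x'‖ → ((x, w) : (EuclideanSpace ℝ (Fin 2)) × (EuclideanSpace ℝ (Fin 2))) = (x', w') := by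
      intro h1 h1'
      rw [hGband x w h1.le, hGband x' w' h1'.le] at h
      obtain ⟨hxx, hww⟩ := flowOut_inj hν hνi hνd hνM hΦs h0 hadd hclock (hband_abs h1 hx.le) (hband_abs h1' hx'.le) h
      exact Prod.ext hxx (smul_right_injective _ hcpos.ne' hww)
    -- deep against far band: separated by the level gap
    have hsep : ∀ {y v y' v' : EuclideanSpace ℝ (Fin 2)}, ‖y‖ ≤ 1 - s₁ → ‖v‖ < 2 → 1 - s₀ < ‖y'‖ → ‖y'‖ < 1 → G (y, v) ≠ G (y', v') := by
      intro y v y' v' hy hv h1' h2' heq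
      rw [hGband y' v' (by linarith)] at heq
      exact hKshell _ (hGK y v hy hv) _ (hνM _) (1 - ‖y'‖) (by linarith) (by linarith) heq
    -- both deep: the thin tube is injective
    have hdd : ‖x‖ ≤ 1 - s₀ → ‖x'‖ ≤ 1 - s₀ → ((x, w) : (EuclideanSpace ℝ (Fin 2)) × (EuclideanSpace ℝ (Fin 2))) = (x', w') := by
      intro h2 h2'
      have h' : G₀ (x, c • w) = G₀ (x', c • w') := h
      have hm : ((x, c • w) : (EuclideanSpace ℝ (Fin 2)) × (EuclideanSpace ℝ (Fin 2))) ∈ closedBall (0 : EuclideanSpace ℝ (Fin 2)) (1 - s₀) ×ˢ ball (0 : EuclideanSpace ℝ (Fin 2)) η₁ :=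
        mk_mem_prod (mem_closedBall_zero_iff.2 h2) (mem_ball_zero_iff.2 (hcw hw).1)
      have hm' : ((x', c • w') : (EuclideanSpace ℝ (Fin 2)) × (EuclideanSpace ℝ (Fin 2))) ∈ closedBall (0 : EuclideanSpace ℝ (Fin 2)) (1 - s₀) ×ˢ ball (0 : EuclideanSpace ℝ (Fin 2)) η₁ :=
        mk_mem_prod (mem_closedBall_zero_iff.2 h2') (mem_ball_zero_iff.2 (hcw hw').1)
      have key := hinjOn hm hm' h'
      rw [Prod.mk.injEq] at key
      exact Prod.ext key.1 (smul_right_injective _ hcpos.ne' key.2)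
    by_cases h1 : 1 - s₁ < ‖x‖ <;> by_cases h1' : 1 - s₁ < ‖x'‖
    · exact hbb h1 h1'
    · push Not at h1'
      by_cases h2 : ‖x‖ ≤ 1 - s₀
      · exact hdd h2 (by linarith)
      · exact absurd h.symm (hsep h1' hw' (lt_of_not_ge h2) hx)
    · push Not at h1
      by_cases h2 : ‖x'‖ ≤ 1 - s₀
      · exact hdd (by linarith) h2
      · exact absurd h (hsep h1 hw (lt_of_not_ge h2) hx')
    · push Not at h1 h1'
      exact hdd (by linarith) (by linarith)
  · -- immersion
    rintro ⟨x, w⟩ ⟨hx, hw⟩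
    rw [mem_ball_zero_iff] at hx hw
    by_cases h1 : ‖x‖ ≤ 1 - s₀
    · have hd : HasFDerivAt G₀ (fderiv ℝ G₀ (x, c • w)) (Sc (x, w)) :=
        ((hG₀at (x, c • w) (by simp only; linarith)).differentiableAt (by simp)).hasFDerivAt
      have hcomp : HasFDerivAt G ((fderiv ℝ G₀ (x, c • w)).comp Sc) (x, w) := by
        rw [hGS]; exact hd.comp (x, w) Sc.hasFDerivAt
      rw [hcomp.fderiv]
      obtain ⟨e, he⟩ := hequiv x (mem_closedBall_zero_iff.2 h1) (c • w) (hcw hw).2.1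
      have : Injective (fderiv ℝ G₀ (x, c • w)) := by rw [← he]; exact e.injective
      exact this.comp hSc_inj
    · push Not at h1
      have hs₁x : 1 - s₁ < ‖x‖ := by linarith
      have hev : G =ᶠ[𝓝 (x, w)] (C ∘ Sc) := by
        have ho : IsOpen {q : (EuclideanSpace ℝ (Fin 2)) × (EuclideanSpace ℝ (Fin 2)) | 1 - s₁ < ‖q.1‖} :=
          isOpen_lt continuous_const (continuous_norm.comp continuous_fst)
        filter_upwards [ho.mem_nhds (show 1 - s₁ < ‖x‖ from hs₁x)] with q hq
        exact hGband q.1 q.2 (le_of_lt hq)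
      rw [hev.fderiv_eq]
      have hx0 : x ≠ 0 := hband_ne hs₁x
      have hCd : HasFDerivAt C (fderiv ℝ C (x, c • w)) (Sc (x, w)) :=
        ((contDiffAt_flowOut hν hΦs (q := (x, c • w)) hx0).differentiableAt (by simp)).hasFDerivAt
      rw [(hCd.comp (x, w) Sc.hasFDerivAt).fderiv]
      exact (injective_fderiv_flowOut hν hνi hνd hνM hΦs h0 hadd hclock hx0 (hband_abs' hs₁x hx.le)).comp hSc_inj
  · -- off `D_k`
    rintro ⟨x, w⟩ ⟨hx, hw⟩
    rw [mem_ball_zero_iff] at hx hw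
    by_cases h1 : ‖x‖ ≤ 1 - s₁
    · exact hnotMem x (mem_closedBall_zero_iff.2 h1) (c • w) (by linarith [(hcw hw).2.2])
    · push Not at h1
      rw [hGband x w h1.le]
      exact flowOut_notMem hνM hclock (c • w) (hband_abs h1 hx.le) hx
  · -- zero section
    intro x _
    change G₀ (x, c • 0) = g x
    rw [smul_zero, hG₀zero]
  · -- the flow-out over the band
    intro u t w ht1 ht2 _
    have ht : 0 < t := by linarith
    have hn : ‖t • (u : EuclideanSpace ℝ (Fin 2))‖ = t := norm_smul_coe_sphere ht.le u
    rw [hGband _ w (by rw [hn]; exact ht1.le)]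
    exact flowOut_smul_coe ht u (c • w)
  · -- the deep part misses the shell
    intro x w hx hw a ha s hs0 hs
    by_cases h1 : ‖x‖ ≤ 1 - s₁
    · exact hKshell _ (hGK x w h1 hw) a ha s hs0 hs
    · push Not at h1
      intro heq
      rw [hGband x w h1.le] at heq
      have hlev : levelFun k (C (x, c • w)) = 2 - ‖x‖ := (flowOut_level hνM hclock (c • w) (hband_abs h1 (by linarith))).2
      have hsε : |s| ≤ 2 * ε := by rw [abs_of_pos hs0]; linarith
      have hlev' := (hclock a ha s hsε).2
      rw [heq] at hlev
      linarith

end FriendsCarrierVk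

open FriendsCarrierVk in
/-- **Part B of the split of `helper_friendsCarrier_Vk` — the flow-conical normal form with its framed tube.**
For a neat model slice disc `f₁` of the model knot `K₁`, a tube `νK : 𝕊¹ × ℝ² → M_k` of `K₁` and a transversal
framing `(n₀, n₁)` of `f₁` over the closed disc equal along the circle to the fibre derivatives of `νK`,
there are: a `C^∞` complete flow `Φ` of `ℝ⁴` with the clock `G_k(Φ(s, x)) = 1 + s` (`x ∈ M_k`,
`|s| ≤ 2ε`, `ε = 1/200`) and the band clause; a model slice disc `g` of `K₁` with the same image
`g(𝔻²) = f₁(𝔻²)` which on the band `1 - s₁ ≤ t ≤ 1` is the flow line `g(t u) = Φ(1 - t, K₁ u)`; a scale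
`0 < c ≤ 1`; and a trivialised tube `G` of the open disc (`C^∞` injective immersion of `D̊² × B(0,2)` off
`D_k`, `G(x, 0) = g x`) which over `1 - s₁ < t < 1` is the flow-out `G(t u, w) = Φ(1 - t, νK(u, c • w))`
and whose deep part `‖x‖ ≤ 1 - s₀` misses the shell `Φ((0, s₀) × M_k)`.
[cite: Kosinski1993, Ch. III Thm (4.2)] [cite: Hirsch1976, Ch. 4 §5 Thm. 5.1] -/
theorem helper_friendsCarrier_Vk_partB : ∀ (k : ℕ) (K₁ : (sphere (0 : EuclideanSpace ℝ (Fin 2)) 1) → EuclideanSpace ℝ (Fin 4)) (f₁ : EuclideanSpace ℝ (Fin 2) → EuclideanSpace ℝ (Fin 4)) (νK : (sphere (0 : EuclideanSpace ℝ (Fin 2)) 1) × EuclideanSpace ℝ (Fin 2) → EuclideanSpace ℝ (Fin 4)), IsModelKnot k K₁ → IsModelSliceDisc k K₁ f₁ → (∀ t : (sphere (0 : EuclideanSpace ℝ (Fin 2)) 1), deriv (fun ρ : ℝ => levelFun k (f₁ (ρ • (t : EuclideanSpace ℝ (Fin 2))))) 1 < 0) → ContMDiff ((𝓡 1).prod 𝓘(ℝ,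 EuclideanSpace ℝ (Fin 2))) 𝓘(ℝ, EuclideanSpace ℝ (Fin 4)) ∞ νK → Injective νK → (∀ p, Injective (mfderiv ((𝓡 1).prod 𝓘(ℝ, EuclideanSpace ℝ (Fin 2))) 𝓘(ℝ, EuclideanSpace ℝ (Fin 4)) νK p)) → (∀ p, νK p ∈ modelBoundary k) → (∀ u : (sphere (0 : EuclideanSpace ℝ (Fin 2)) 1), νK (u, 0) = K₁ u) → ∀ (n₀ n₁ : EuclideanSpace ℝ (Fin 2) → EuclideanSpace ℝ (Fin 4)), ContDiff ℝ ∞ n₀ ∧ ContDiff ℝ ∞ n₁ ∧ (∀ x ∈ closedBall (0 : EuclideanSpace ℝ (Fin 2)) 1, ∀ (v : EuclideanSpace ℝ (Fin 2)) (a b : ℝ), fderiv ℝ f₁ x v + a • n₀ x + b • n₁ x = 0 → v = 0 ∧ a = 0 ∧ b = 0) ∧ (∀ u : (sphere (0 : EuclideanSpace ℝ (Fin 2)) 1), n₀ u = fderiv ℝ (fun w : EuclideanSpace ℝ (Fin 2) => νK (u, w)) 0 (EuclideanSpace.single 0 1) ∧ n₁ u = fderiv ℝ (fun w : EuclideanSpace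 ℝ (Fin 2) => νK (u, w)) 0 (EuclideanSpace.single 1 1)) → ∃ (Φ : ℝ × EuclideanSpace ℝ (Fin 4) → EuclideanSpace ℝ (Fin 4)) (ε s₁ s₀ c : ℝ) (g : EuclideanSpace ℝ (Fin 2) → EuclideanSpace ℝ (Fin 4)) (G : EuclideanSpace ℝ (Fin 2) × EuclideanSpace ℝ (Fin 2) → EuclideanSpace ℝ (Fin 4)), ContDiff ℝ ∞ Φ ∧ (∀ x, Φ (0, x) = x) ∧ (∀ s t x, Φ (s, Φ (t, x)) = Φ (s + t, x)) ∧ 0 < ε ∧ ε ≤ 1 / 4 ∧ (∀ x ∈ modelBoundary k, ∀ s : ℝ, |s| ≤ 2 * ε → (∀ j, (1 : ℝ) / 2 < holeTerm k j (Φ (s, x))) ∧ levelFun k (Φ (s, x)) = 1 + s) ∧ (∀ y, (∀ j, 0 < holeTerm k j y) → |levelFun k y - 1| < 2 * ε → Φ (1 - levelFun k y, y) ∈ modelBoundary k) ∧ 0 < s₀ ∧ s₀ < s₁ ∧ s₁ < 2 * ε ∧ 0 < c ∧ c ≤ 1 ∧ IsModelSliceDisc k K₁ g ∧ g '' closedBall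 0 1 = f₁ '' closedBall 0 1 ∧ (∀ (u : (sphere (0 : EuclideanSpace ℝ (Fin 2)) 1)) (t : ℝ), 1 - s₁ ≤ t → t ≤ 1 → g (t • (u : EuclideanSpace ℝ (Fin 2))) = Φ (1 - t, K₁ u)) ∧ ContDiffOn ℝ ∞ G (ball 0 1 ×ˢ ball 0 2) ∧ InjOn G (ball 0 1 ×ˢ ball 0 2) ∧ (∀ q ∈ ball 0 1 ×ˢ ball 0 2, Injective (fderiv ℝ G q)) ∧ (∀ q ∈ ball 0 1 ×ˢ ball 0 2, G q ∉ modelHandlebody k) ∧ (∀ x ∈ ball 0 1, G (x, 0) = g x) ∧ (∀ (u : (sphere (0 : EuclideanSpace ℝ (Fin 2)) 1)) (t : ℝ) (w : EuclideanSpace ℝ (Fin 2)), 1 - s₁ < t → t < 1 → ‖w‖ < 2 → G (t • (u : EuclideanSpace ℝ (Fin 2)), w) = Φ (1 - t, νK (u, c • w))) ∧ (∀ (x w : EuclideanSpace ℝ (Fin 2)), ‖x‖ ≤ 1 - s₀ → ‖w‖ < 2 → ∀ a ∈ modelBoundary k, ∀ s : ℝ, 0 < s → s < s₀ → G (x, w)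 ≠ Φ (s, a)) := by
  intro k K₁ f₁ νK hK hf hneat hν hνi hνd hνM hν0 n₀ n₁ hn
  obtain ⟨hn₀, hn₁, htrans, hbdry⟩ := hn
  -- the clocked flow of the neat-adapted field
  obtain ⟨V, R, δ', hVs, hδ', hVR, hVclock, htan⟩ := exists_adaptedFieldNeat k hK hf hneat
  obtain ⟨Φ, hΦs, hΦ0, hadd, hder, -, hclock, hband⟩ :=
    helper_friendsCarrier_Vk_clockFlow k V (1 / 200) R (by norm_num) (by norm_num) hVs hVR hVclock
  -- the reparametrised disc
  obtain ⟨g, Rm, τ₁, hτ₁, hτ₁1, hg, himage, hgR, hRs, hRimm, hRle, hRcirc, hgout, hgband⟩ :=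
    exists_flowDisc k hK hf hneat hVs hVR hδ' htan hΦs hder hΦ0
  -- the tube
  obtain ⟨s₁, s₀, c, G, hs₀, hs₀s₁, hs₁τ, hs₁ε, hc, hc1, hGs, hGinj, hGimm, hGD, hGzero, hGband, hGshell⟩ :=
    exists_flowTubeG hf hν hνi hνd hνM hν0 hΦs hΦ0 hadd hclock (by norm_num) hg hτ₁ hτ₁1 hgR hRs hRimm hRle hRcirc hgout
      hn₀ hn₁ htrans hbdry
  refine ⟨Φ, 1 / 200, s₁, s₀, c, g, G, hΦs, hΦ0, hadd, by norm_num, by norm_num, hclock, hband, hs₀, hs₀s₁, hs₁ε, hc, hc1,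
    hg, himage, fun u t ht1 ht2 => hgband u t (by linarith) ht2, hGs, hGinj, hGimm, hGD, hGzero, hGband, hGshell⟩

end Summit.SmoothPoincare4.SmoothPoincare4.Theorems.DcrGap.MkFriends

end
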